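import Summits.HubbardSuperconductivity.HubbardSuperconductivity.Theorems.AnisotropyChordTransferFibre3DenMinRestLattice
import Summits.HubbardSuperconductivity.HubbardSuperconductivity.Theorems.AnisotropyChordTransferFibre3KT2aRow
import Summits.HubbardSuperconductivity.HubbardSuperconductivity.Theorems.AnisotropyChordTransferFibre3B1Weighted
import Summits.HubbardSuperconductivity.HubbardSuperconductivity.Theorems.AnisotropyChordTransferFibre3B1Instances
import Summits.HubbardSuperconductivity.HubbardSuperconductivity.Theorems.AnisotropyChordTransferFibre3RowCShellWinLemmas

/-!
# Route `AnisotropyChord` / H0 rotor rung, row D (KT-2a): `LowSetExplicit` PROVED — the low set is the explicit 45-point list for every `L ≥ 8`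

PartN41-D (`…KT2aRow`) §2 types `LowSetExplicit L : 8 ≤ L → lowSet L = (lowList.map toTor×toTor).toFinset`: the two lowest
non-pole free shells of the `K₁` fibre (`IsLowShell`: not a pole and `ε(K₁−k₂−k₃) + ε(k₂) + ε(k₃) < 5.5ε₁`) are EXACTLY the 45
listed integer points, uniformly in `L ≥ 8`.  Every row-D evaluator enumerates this set (the KT-2a sum `lowG` runs over `lowSet`).
Proof = g22's `DenMinRestLattice` case analysis run to the end: on the centred representatives `(x_i, y_i)` of the three momenta
(`Σx ≡ 1`, `Σy ≡ 0`), a coordinate with `|r| ≥ 3` forces `Σε ≥ (5 + 2cos θ)ε₁ ≥ 5.5ε₁` (`axisX_large`/`axisY_large`); otherwise all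
`|r| ≤ 2`, the sums are exact, `Σε = (N₁ + 2(1 + cos θ)N₂)ε₁` with `N₁`/`N₂` the numbers of `±1`/`±2` coordinates (`wInt_small`), and
`2 + √2 ≤ 2(1 + cos θ) ≤ 4`; the INTEGER facts — every small tuple has `10N₁ + 34N₂ ≥ 55` or is listed or is a pole (`lowInt_exhaust`),
and every listed point is small, has `N₁ + 4N₂ ≤ 5` and is not a pole (`lowList_facts`) — are kernel `decide`s over the `5⁴` box.
★ `lowSetExplicit_holds : LowSetExplicit L`; also `RowD.mem_lowSet_iff_mem_lowList`, the evaluator forms `RowD.lowSet_eq_image`,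
`RowD.sum_lowSet_eq` (a sum over `lowSet` is the sum over the list, the map being injective on it) and `RowD.lowSet_card = 45`.
Prover seat `hubbard-h0-rotor-p1` g29 (route lead); helper for piece A = stmt-HubbardSuperconductivity-23918 of rung 19089
(`--supports`, helper class).  Nothing here proves superconductivity in the Hubbard model; one lemma of ONE conditional reduction
(the GM₃ ∀L certificate, row D); the rotor TARGET as originally worded stays FALSE (g15 verdict).  Mathlib + the tree only; no sorry.
-/

set_option linter.dupNamespace false
set_option autoImplicit false

noncomputable section

open scoped BigOperators

namespace Summit.HubbardSuperconductivity.HubbardSuperconductivity.Theorems.AnisotropyChord.Transfer.Fibre3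

variable (L : ℕ) [NeZero L]

namespace RowD

/-! ## Integer side: counts, the pole list, the two exhaustions -/

/-! The six centred representatives determined by `(k₂, k₃) = (P, Q)` are `1 − P.1 − Q.1, P.1, Q.1` (x) and `−P.2 − Q.2, P.2, Q.2` (y);
`N₁ := Σ n1(·)` counts the `±1`'s, `N₂ := Σ n2(·)` the `±2`'s (g22's `n1`, `n2`); the poles are `(P, Q) ∈ {((0,0),(0,0)), ((1,0),(0,0)),
((0,0),(1,0))}`.  (Written out in full below to keep this a pure proof file.) -/

/-- EXHAUSTION over the small box: a small tuple is heavy (`10N₁ + 34N₂ ≥ 55`), listed, or a pole. [folklore] -/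
theorem lowInt_exhaust :
    ∀ pq ∈ (B1.box 2) ×ˢ (B1.box 2),
      ((1, 0) - pq.1 - pq.2 ∈ B1.box 2) →
        55 ≤ 10 * (n1 (1 - pq.1.1 - pq.2.1) + n1 pq.1.1 + n1 pq.2.1 + n1 (-pq.1.2 - pq.2.2) + n1 pq.1.2 + n1 pq.2.2)
              + 34 * (n2 (1 - pq.1.1 - pq.2.1) + n2 pq.1.1 + n2 pq.2.1 + n2 (-pq.1.2 - pq.2.2) + n2 pq.1.2 + n2 pq.2.2)
          ∨ pq ∈ lowList ∨ pq ∈ [(((0 : ℤ), (0 : ℤ)), ((0 : ℤ), (0 : ℤ))), ((1, 0), (0, 0)), ((0, 0), (1, 0))] := by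
  unfold B1.box n1 n2 lowList
  decide +kernel

/-- the listed points are small, light (`N₁ + 4N₂ ≤ 5`) and not poles. [folklore] -/
theorem lowList_facts :
    ∀ pq ∈ lowList,
      pq.1 ∈ B1.box 2 ∧ pq.2 ∈ B1.box 2 ∧ ((1, 0) - pq.1 - pq.2 ∈ B1.box 2) ∧
        (n1 (1 - pq.1.1 - pq.2.1) + n1 pq.1.1 + n1 pq.2.1 + n1 (-pq.1.2 - pq.2.2) + n1 pq.1.2 + n1 pq.2.2)
            + 4 * (n2 (1 - pq.1.1 - pq.2.1) + n2 pq.1.1 + n2 pq.2.1 + n2 (-pq.1.2 - pq.2.2) + n2 pq.1.2 + n2 pq.2.2) ≤ 5 ∧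
          pq ∉ [(((0 : ℤ), (0 : ℤ)), ((0 : ℤ), (0 : ℤ))), ((1, 0), (0, 0)), ((0, 0), (1, 0))] := by
  unfold B1.box n1 n2 lowList
  decide +kernel

/-! ## Torus side: small representatives read back -/

omit [NeZero L] in
/-- `K₁ = toTor (1, 0)`. [folklore] -/
theorem K1_eq_toTor : K1 L = B1.toTor L (1, 0) := by
  unfold K1 B1.toTor
  ext <;> simp

/-- `toTor` is injective on the box `[−2, 2]²` for `L ≥ 5`. [folklore] -/
theorem toTor_injOn_box (hL : 5 ≤ L) {p q : ℤ × ℤ} (hp : p ∈ B1.box 2) (hq : q ∈ B1.box 2)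
    (h : B1.toTor L p = B1.toTor L q) : p = q := by
  have h2 : 2 * 2 < L := by omega
  rw [← B1.rep_toTor_of_mem_box L 2 h2 p hp, ← B1.rep_toTor_of_mem_box L 2 h2 q hq, h]

omit [NeZero L] in
/-- `(0,0)` and `(1,0)` lie in the box. [folklore] -/
theorem zero_one_mem_box : ((0, 0) : ℤ × ℤ) ∈ B1.box 2 ∧ ((1, 0) : ℤ × ℤ) ∈ B1.box 2 := by
  unfold B1.box; decide

/-- for small `p, q`: `IsPoleK1 (toTor p) (toTor q) = true ↔ (p, q)` is one of the three integer poles (`L ≥ 5`). [folklore] -/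
theorem isPoleK1_toTor_iff (hL : 5 ≤ L) {p q : ℤ × ℤ} (hp : p ∈ B1.box 2) (hq : q ∈ B1.box 2) :
    IsPoleK1 L (B1.toTor L p) (B1.toTor L q) = true ↔
      (p, q) ∈ [(((0 : ℤ), (0 : ℤ)), ((0 : ℤ), (0 : ℤ))), ((1, 0), (0, 0)), ((0, 0), (1, 0))] := by
  have h0 : B1.toTor L ((0, 0) : ℤ × ℤ) = 0 := B1.toTor_zero L
  have hz := (zero_one_mem_box).1
  have ho := (zero_one_mem_box).2
  have e0 : ∀ {r : ℤ × ℤ}, r ∈ B1.box 2 → (B1.toTor L r = 0 ↔ r = (0, 0)) := fun {r} hr => by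
    constructor
    · intro h; exact toTor_injOn_box L hL hr hz (by rw [h, h0])
    · rintro rfl; exact h0
  have e1 : ∀ {r : ℤ × ℤ}, r ∈ B1.box 2 → (B1.toTor L r = K1 L ↔ r = (1, 0)) := fun {r} hr => by
    rw [K1_eq_toTor]
    constructor
    · intro h; exact toTor_injOn_box L hL hr ho h
    · rintro rfl; rfl
  unfold IsPoleK1
  simp only [Bool.or_eq_true, Bool.and_eq_true, decide_eq_true_eq, e0 hp, e0 hq, e1 hp, e1 hq, List.mem_cons,
    Prod.mk.injEq, List.not_mem_nil, or_false, or_assoc]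

/-! ## The energy of small representatives -/

/-- `0.7 ≤ √2/2`. [folklore] -/
theorem sqrt2_div_two_ge : (0.7 : ℝ) ≤ Real.sqrt 2 / 2 := by
  have h2 := Real.sq_sqrt (show (0 : ℝ) ≤ 2 by norm_num)
  have h0 := Real.sqrt_nonneg 2
  nlinarith

omit [NeZero L] in
/-- `2 + √2 ≤ 2(1 + cos θ) ≤ 4` for `L ≥ 8`; we use `3.4 ≤ 2(1 + cos θ)`. [folklore] -/
theorem two_one_add_cos_bounds (hL : 8 ≤ L) :
    3.4 ≤ 2 * (1 + Real.cos (2 * Real.pi / L)) ∧ 2 * (1 + Real.cos (2 * Real.pi / L)) ≤ 4 := by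
  have hc := sqrt2_div_two_le_cos L hL
  have h1 := Real.cos_le_one (2 * Real.pi / L)
  have hs := sqrt2_div_two_ge
  constructor <;> linarith

/-- the free energy of `(k₂, k₃) = (toTor p, toTor q)` for small `p, q` with small `k₁ = (1,0) − p − q`:
`Σε = (N₁ + 2(1 + cos θ)N₂)·ε₁` (`L ≥ 5`). [folklore] -/
theorem energy_small (hL : 5 ≤ L) {p q : ℤ × ℤ} (hp : p ∈ B1.box 2) (hq : q ∈ B1.box 2)
    (h1 : (1, 0) - p - q ∈ B1.box 2) :
    epsT L (K1 L - B1.toTor L p - B1.toTor L q) + epsT L (B1.toTor L p) + epsT L (B1.toTor L q)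
      = (((n1 (1 - p.1 - q.1) + n1 p.1 + n1 q.1 + n1 (-p.2 - q.2) + n1 p.2 + n1 q.2 : ℕ) : ℝ)
          + 2 * (1 + Real.cos (2 * Real.pi / L))
            * ((n2 (1 - p.1 - q.1) + n2 p.1 + n2 q.1 + n2 (-p.2 - q.2) + n2 p.2 + n2 q.2 : ℕ) : ℝ)) * eps1 L := by
  have h2 : 2 * 2 < L := by omega
  have rp := B1.rep_toTor_of_mem_box L 2 h2 p hp
  have rq := B1.rep_toTor_of_mem_box L 2 h2 q hq
  have r1 := B1.rep_toTor_of_mem_box L 2 h2 _ h1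
  have ek1 : K1 L - B1.toTor L p - B1.toTor L q = B1.toTor L ((1, 0) - p - q) := by
    rw [RowC.toTor_sub, RowC.toTor_sub, K1_eq_toTor]
  unfold B1.rep at rp rq r1
  have hp1 : (B1.toTor L p).1.valMinAbs = p.1 := congrArg Prod.fst rp
  have hp2 : (B1.toTor L p).2.valMinAbs = p.2 := congrArg Prod.snd rp
  have hq1 : (B1.toTor L q).1.valMinAbs = q.1 := congrArg Prod.fst rq
  have hq2 : (B1.toTor L q).2.valMinAbs = q.2 := congrArg Prod.snd rq
  have h11 : (B1.toTor L ((1, 0) - p - q)).1.valMinAbs = 1 - p.1 - q.1 := by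
    have := congrArg Prod.fst r1; simpa using this
  have h12 : (B1.toTor L ((1, 0) - p - q)).2.valMinAbs = -p.2 - q.2 := by
    have := congrArg Prod.snd r1; simpa using this
  rw [B1.mem_box_iff] at hp hq h1
  obtain ⟨⟨hp11, hp12⟩, ⟨hp21, hp22⟩⟩ := hp
  obtain ⟨⟨hq11, hq12⟩, ⟨hq21, hq22⟩⟩ := hq
  obtain ⟨⟨h111, h112⟩, ⟨h121, h122⟩⟩ := h1
  simp only [Prod.fst_sub, Prod.snd_sub] at h111 h112 h121 h122
  push_cast at hp11 hp12 hp21 hp22 hq11 hq12 hq21 hq22 h111 h112 h121 h122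
  have sp1 : |p.1| ≤ 2 := abs_le.mpr ⟨by omega, by omega⟩
  have sp2 : |p.2| ≤ 2 := abs_le.mpr ⟨by omega, by omega⟩
  have sq1 : |q.1| ≤ 2 := abs_le.mpr ⟨by omega, by omega⟩
  have sq2 : |q.2| ≤ 2 := abs_le.mpr ⟨by omega, by omega⟩
  have s11 : |1 - p.1 - q.1| ≤ 2 := abs_le.mpr ⟨by omega, by omega⟩
  have s12 : |-p.2 - q.2| ≤ 2 := abs_le.mpr ⟨by omega, by omega⟩
  rw [ek1, epsT_eq_wInt, epsT_eq_wInt, epsT_eq_wInt, hp1, hp2, hq1, hq2, h11, h12,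
    wInt_small L _ s11, wInt_small L _ s12, wInt_small L _ sp1, wInt_small L _ sp2, wInt_small L _ sq1,
    wInt_small L _ sq2]
  push_cast
  ring

/-! ## The two inclusions -/

/-- every listed point lies in the low set (`L ≥ 8`). [folklore] -/
theorem mem_lowSet_of_mem_lowList (hL : 8 ≤ L) {pq : (ℤ × ℤ) × (ℤ × ℤ)} (hpq : pq ∈ lowList) :
    (B1.toTor L pq.1, B1.toTor L pq.2) ∈ lowSet L := by
  classical
  obtain ⟨hp, hq, h1, hN, hnp⟩ := lowList_facts pq hpq
  have hL5 : 5 ≤ L := by omega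
  unfold lowSet
  rw [Finset.mem_filter]
  refine ⟨Finset.mem_univ _, ?_, ?_⟩
  · -- not a pole
    cases h : IsPoleK1 L (B1.toTor L pq.1) (B1.toTor L pq.2)
    · rfl
    · exact absurd ((isPoleK1_toTor_iff L hL5 hp hq).mp h) hnp
  · -- energy < 5.5 ε₁
    rw [energy_small L hL5 hp hq h1]
    set N1 : ℕ := n1 (1 - pq.1.1 - pq.2.1) + n1 pq.1.1 + n1 pq.2.1 + n1 (-pq.1.2 - pq.2.2) + n1 pq.1.2 + n1 pq.2.2
    set N2 : ℕ := n2 (1 - pq.1.1 - pq.2.1) + n2 pq.1.1 + n2 pq.2.1 + n2 (-pq.1.2 - pq.2.2) + n2 pq.1.2 + n2 pq.2.2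
    have hε : 0 < eps1 L := eps1_pos L (by omega)
    have hc := (two_one_add_cos_bounds L hL).2
    have hNr : (N1 : ℝ) + 4 * (N2 : ℝ) ≤ 5 := by exact_mod_cast hN
    have h2 : (0 : ℝ) ≤ (N2 : ℝ) := by positivity
    have hle : (N1 : ℝ) + 2 * (1 + Real.cos (2 * Real.pi / L)) * (N2 : ℝ) ≤ 5 := by
      have := mul_le_mul_of_nonneg_right hc h2
      linarith
    have h55 : (5 : ℝ) < 5.5 := by norm_num
    calc ((N1 : ℝ) + 2 * (1 + Real.cos (2 * Real.pi / L)) * (N2 : ℝ)) * eps1 L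
        ≤ 5 * eps1 L := mul_le_mul_of_nonneg_right hle hε.le
      _ < 5.5 * eps1 L := mul_lt_mul_of_pos_right h55 hε

/-- every point of the low set is listed (`L ≥ 8`). [folklore] -/
theorem exists_lowList_of_mem_lowSet (hL : 8 ≤ L) {k : Tor L × Tor L} (hk : k ∈ lowSet L) :
    ∃ pq ∈ lowList, (B1.toTor L pq.1, B1.toTor L pq.2) = k := by
  classical
  obtain ⟨k₂, k₃⟩ := k
  unfold lowSet at hk
  rw [Finset.mem_filter] at hk
  obtain ⟨hpole, hlow⟩ := hk.2
  have hL0 : 0 < L := by omega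
  have hL5 : 5 ≤ L := by omega
  have hc0 : 0 ≤ Real.cos (2 * Real.pi / L) := le_trans (by positivity) (sqrt2_div_two_le_cos L hL)
  have hε : 0 < eps1 L := eps1_pos L (by omega)
  -- representatives
  set k₁ := K1 L - k₂ - k₃ with hk₁
  obtain ⟨x₁, hx₁⟩ : ∃ x : ℤ, k₁.1.valMinAbs = x := ⟨_, rfl⟩
  obtain ⟨x₂, hx₂⟩ : ∃ x : ℤ, k₂.1.valMinAbs = x := ⟨_, rfl⟩
  obtain ⟨x₃, hx₃⟩ : ∃ x : ℤ, k₃.1.valMinAbs = x := ⟨_, rfl⟩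
  obtain ⟨y₁, hy₁⟩ : ∃ y : ℤ, k₁.2.valMinAbs = y := ⟨_, rfl⟩
  obtain ⟨y₂, hy₂⟩ : ∃ y : ℤ, k₂.2.valMinAbs = y := ⟨_, rfl⟩
  obtain ⟨y₃, hy₃⟩ : ∃ y : ℤ, k₃.2.valMinAbs = y := ⟨_, rfl⟩
  have bx₁ : 2 * |x₁| ≤ (L : ℤ) := hx₁ ▸ Literature.Probability.LatticeModels.two_mul_abs_valMinAbs_le k₁.1
  have bx₂ : 2 * |x₂| ≤ (L : ℤ) := hx₂ ▸ Literature.Probability.LatticeModels.two_mul_abs_valMinAbs_le k₂.1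
  have bx₃ : 2 * |x₃| ≤ (L : ℤ) := hx₃ ▸ Literature.Probability.LatticeModels.two_mul_abs_valMinAbs_le k₃.1
  have by₁ : 2 * |y₁| ≤ (L : ℤ) := hy₁ ▸ Literature.Probability.LatticeModels.two_mul_abs_valMinAbs_le k₁.2
  have by₂ : 2 * |y₂| ≤ (L : ℤ) := hy₂ ▸ Literature.Probability.LatticeModels.two_mul_abs_valMinAbs_le k₂.2
  have by₃ : 2 * |y₃| ≤ (L : ℤ) := hy₃ ▸ Literature.Probability.LatticeModels.two_mul_abs_valMinAbs_le k₃.2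
  have hE : epsT L k₁ + epsT L k₂ + epsT L k₃
      = (wInt L x₁ + wInt L x₂ + wInt L x₃) + (wInt L y₁ + wInt L y₂ + wInt L y₃) := by
    rw [epsT_eq_wInt, epsT_eq_wInt, epsT_eq_wInt, hx₁, hx₂, hx₃, hy₁, hy₂, hy₃]; ring
  have hk1 : k₁.1 + k₂.1 + k₃.1 = 1 := by
    rw [hk₁, Prod.fst_sub, Prod.fst_sub]; simp only [K1]; ring
  have hk2 : k₁.2 + k₂.2 + k₃.2 = 0 := by
    rw [hk₁, Prod.snd_sub, Prod.snd_sub]; simp only [K1]; ring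
  have hsx : ((x₁ + x₂ + x₃ : ℤ) : ZMod L) = 1 := by
    rw [← hx₁, ← hx₂, ← hx₃]; push_cast; exact hk1
  have hsy : ((y₁ + y₂ + y₃ : ℤ) : ZMod L) = 0 := by
    rw [← hy₁, ← hy₂, ← hy₃]; push_cast; exact hk2
  have hX0 : 0 ≤ wInt L x₁ + wInt L x₂ + wInt L x₃ := by
    have := wInt_nonneg L x₁; have := wInt_nonneg L x₂; have := wInt_nonneg L x₃; linarith
  have hY0 : 0 ≤ wInt L y₁ + wInt L y₂ + wInt L y₃ := by
    have := wInt_nonneg L y₁; have := wInt_nonneg L y₂; have := wInt_nonneg L y₃; linarith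
  have hlow' : (wInt L x₁ + wInt L x₂ + wInt L x₃) + (wInt L y₁ + wInt L y₂ + wInt L y₃) < 5.5 * eps1 L := by
    rw [← hE]; exact hlow
  have h55 : 5.5 * eps1 L ≤ (5 + 2 * Real.cos (2 * Real.pi / L)) * eps1 L := by
    have := sqrt2_div_two_le_cos L hL
    have hs := sqrt2_div_two_ge
    exact mul_le_mul_of_nonneg_right (by linarith) hε.le
  -- Case A (a large coordinate) is impossible
  have hA : ¬ (3 ≤ |x₁| ∨ 3 ≤ |x₂| ∨ 3 ≤ |x₃| ∨ 3 ≤ |y₁| ∨ 3 ≤ |y₂| ∨ 3 ≤ |y₃|) := by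
    intro hA
    rcases hA with h | h | h | h | h | h
    · have := axisX_large L hL bx₁ bx₂ bx₃ hsx h; linarith
    · have := axisX_large L hL bx₂ bx₁ bx₃ (by rw [show x₂ + x₁ + x₃ = x₁ + x₂ + x₃ by ring]; exact hsx) h; linarith
    · have := axisX_large L hL bx₃ bx₁ bx₂ (by rw [show x₃ + x₁ + x₂ = x₁ + x₂ + x₃ by ring]; exact hsx) h; linarith
    · have := axisY_large L hL by₁ by₂ by₃ hsy h; linarith
    · have := axisY_large L hL by₂ by₁ by₃ (by rw [show y₂ + y₁ + y₃ = y₁ + y₂ + y₃ by ring]; exact hsy) h; linarith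
    · have := axisY_large L hL by₃ by₁ by₂ (by rw [show y₃ + y₁ + y₂ = y₁ + y₂ + y₃ by ring]; exact hsy) h; linarith
  push Not at hA
  obtain ⟨a1, a2, a3, a4, a5, a6⟩ := hA
  have sx₁ : |x₁| ≤ 2 := by omega
  have sx₂ : |x₂| ≤ 2 := by omega
  have sx₃ : |x₃| ≤ 2 := by omega
  have sy₁ : |y₁| ≤ 2 := by omega
  have sy₂ : |y₂| ≤ 2 := by omega
  have sy₃ : |y₃| ≤ 2 := by omega
  -- exact integer sums
  have hsumx : x₁ + x₂ + x₃ = 1 := by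
    have hdvd : (L : ℤ) ∣ (x₁ + x₂ + x₃) - 1 := by
      rw [← ZMod.intCast_zmod_eq_zero_iff_dvd, Int.cast_sub, hsx]; simp
    have hlt : |(x₁ + x₂ + x₃) - 1| < (L : ℤ) := by
      rw [abs_lt]; rw [abs_le] at sx₁ sx₂ sx₃; constructor <;> omega
    have := Int.eq_zero_of_abs_lt_dvd hdvd hlt
    omega
  have hsumy : y₁ + y₂ + y₃ = 0 := by
    have hdvd : (L : ℤ) ∣ (y₁ + y₂ + y₃) := by
      rw [← ZMod.intCast_zmod_eq_zero_iff_dvd, hsy]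
    have hlt : |y₁ + y₂ + y₃| < (L : ℤ) := by
      rw [abs_lt]; rw [abs_le] at sy₁ sy₂ sy₃; constructor <;> omega
    exact Int.eq_zero_of_abs_lt_dvd hdvd hlt
  -- the integer point and its box facts
  rw [abs_le] at sx₁ sx₂ sx₃ sy₁ sy₂ sy₃
  have hpbox : ((x₂, y₂) : ℤ × ℤ) ∈ B1.box 2 := by
    rw [B1.mem_box_iff]; dsimp only; push_cast; exact ⟨⟨by omega, by omega⟩, ⟨by omega, by omega⟩⟩
  have hqbox : ((x₃, y₃) : ℤ × ℤ) ∈ B1.box 2 := by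
    rw [B1.mem_box_iff]; dsimp only; push_cast; exact ⟨⟨by omega, by omega⟩, ⟨by omega, by omega⟩⟩
  have h1box : ((1, 0) : ℤ × ℤ) - (x₂, y₂) - (x₃, y₃) ∈ B1.box 2 := by
    rw [B1.mem_box_iff]; simp only [Prod.mk_sub_mk]; push_cast
    exact ⟨⟨by omega, by omega⟩, ⟨by omega, by omega⟩⟩
  have hk₂ : B1.toTor L (x₂, y₂) = k₂ := by rw [← hx₂, ← hy₂]; exact B1.toTor_rep L k₂
  have hk₃ : B1.toTor L (x₃, y₃) = k₃ := by rw [← hx₃, ← hy₃]; exact B1.toTor_rep L k₃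
  -- the energy in counts, and the count inequality
  have hEn := energy_small L hL5 hpbox hqbox h1box
  rw [hk₂, hk₃, ← hk₁] at hEn
  set p : ℤ × ℤ := (x₂, y₂) with hp
  set q : ℤ × ℤ := (x₃, y₃) with hq
  set N1 : ℕ := n1 (1 - p.1 - q.1) + n1 p.1 + n1 q.1 + n1 (-p.2 - q.2) + n1 p.2 + n1 q.2 with hN1
  set N2 : ℕ := n2 (1 - p.1 - q.1) + n2 p.1 + n2 q.1 + n2 (-p.2 - q.2) + n2 p.2 + n2 q.2 with hN2d
  have hlt : ((N1 : ℝ) + 2 * (1 + Real.cos (2 * Real.pi / L)) * (N2 : ℝ)) * eps1 L < 5.5 * eps1 L := by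
    rw [← hEn]; exact hlow
  have hc34 := (two_one_add_cos_bounds L hL).1
  have hN2 : (0 : ℝ) ≤ (N2 : ℝ) := by positivity
  have hcnt : ¬ (55 ≤ 10 * N1 + 34 * N2) := by
    intro h
    have hr : (55 : ℝ) ≤ 10 * (N1 : ℝ) + 34 * (N2 : ℝ) := by exact_mod_cast h
    have h1 : ((N1 : ℝ) + 3.4 * (N2 : ℝ)) * eps1 L
        ≤ ((N1 : ℝ) + 2 * (1 + Real.cos (2 * Real.pi / L)) * (N2 : ℝ)) * eps1 L := by
      refine mul_le_mul_of_nonneg_right ?_ hε.le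
      have := mul_le_mul_of_nonneg_right hc34 hN2
      linarith
    have h2 : (N1 : ℝ) + 3.4 * (N2 : ℝ) < 5.5 := lt_of_mul_lt_mul_right (h1.trans_lt hlt) hε.le
    linarith
  -- exhaustion
  have hex := lowInt_exhaust (p, q) (Finset.mk_mem_product hpbox hqbox) h1box
  rcases hex with h | h | h
  · exact absurd h hcnt
  · exact ⟨(p, q), h, by rw [hk₂, hk₃]⟩
  · -- a pole: contradicts `hpole`
    have := (isPoleK1_toTor_iff L hL5 hpbox hqbox).mpr h
    rw [hk₂, hk₃] at this
    rw [this] at hpole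
    exact absurd hpole (by decide)

/-- ★ membership: `k ∈ lowSet L ↔ k` is the image of a listed point (`L ≥ 8`). [folklore] -/
theorem mem_lowSet_iff_mem_lowList (hL : 8 ≤ L) (k : Tor L × Tor L) :
    k ∈ lowSet L ↔ ∃ pq ∈ lowList, (B1.toTor L pq.1, B1.toTor L pq.2) = k := by
  constructor
  · exact exists_lowList_of_mem_lowSet L hL
  · rintro ⟨pq, hpq, rfl⟩; exact mem_lowSet_of_mem_lowList L hL hpq

end RowD

/-- ★★ **`LowSetExplicit L` holds**: for `L ≥ 8` the low set is the image of the explicit 45-point list. [folklore] -/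
theorem lowSetExplicit_holds : LowSetExplicit L := by
  intro hL
  ext k
  rw [RowD.mem_lowSet_iff_mem_lowList L hL, List.mem_toFinset, List.mem_map]

namespace RowD

/-- the list has no duplicates. [folklore] -/
theorem lowList_nodup : lowList.Nodup := by
  unfold lowList; decide

/-- the reading map is injective on the listed points (`L ≥ 5`). [folklore] -/
theorem toTor_pair_injOn (hL : 5 ≤ L) :
    Set.InjOn (fun pq : (ℤ × ℤ) × (ℤ × ℤ) => (B1.toTor L pq.1, B1.toTor L pq.2)) ↑(lowList.toFinset) := by
  intro a ha b hb h
  rw [Finset.mem_coe, List.mem_toFinset] at ha hb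
  obtain ⟨ha1, ha2, -⟩ := lowList_facts a ha
  obtain ⟨hb1, hb2, -⟩ := lowList_facts b hb
  simp only [Prod.mk.injEq] at h
  exact Prod.ext (toTor_injOn_box L hL ha1 hb1 h.1) (toTor_injOn_box L hL ha2 hb2 h.2)

/-- ★ evaluator form: `lowSet = image of the list's finset` (`L ≥ 8`). [folklore] -/
theorem lowSet_eq_image (hL : 8 ≤ L) :
    lowSet L = lowList.toFinset.image (fun pq => (B1.toTor L pq.1, B1.toTor L pq.2)) := by
  rw [lowSetExplicit_holds L hL]
  ext k
  simp only [List.mem_toFinset, List.mem_map, Finset.mem_image]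

/-- ★ evaluator form: a sum over the low set is the sum over the 45 listed points (`L ≥ 8`). [folklore] -/
theorem sum_lowSet_eq {M : Type*} [AddCommMonoid M] (hL : 8 ≤ L) (φ : Tor L × Tor L → M) :
    ∑ k ∈ lowSet L, φ k = ∑ pq ∈ lowList.toFinset, φ (B1.toTor L pq.1, B1.toTor L pq.2) := by
  rw [lowSet_eq_image L hL, Finset.sum_image (toTor_pair_injOn L (by omega))]

/-- ★ `|lowSet| = 45` for every `L ≥ 8`. [folklore] -/
theorem lowSet_card (hL : 8 ≤ L) : (lowSet L).card = 45 := by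
  rw [lowSet_eq_image L hL, Finset.card_image_of_injOn (toTor_pair_injOn L (by omega)),
    List.toFinset_card_of_nodup lowList_nodup]
  rfl

end RowD

end Summit.HubbardSuperconductivity.HubbardSuperconductivity.Theorems.AnisotropyChord.Transfer.Fibre3

end
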